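import Summits.HodgeConjecture.CorCM.CMAbelianFactorsDimLeThreeObstructions
import HarnessLib

/-!
# Complex abelian varieties of CM type ALL of whose simple isogeny factors have dimension `≤ 3`: all powers are
# divisor-generated — and the Hodge conjecture holds on everything they dominate — iff (i′) no imaginary quadratic field
# maps into the endomorphism algebras of two non-isogenous simple factors, (ii′) at most three isogeny classes of simple
# threefold factors per endomorphism field, (iii′) at most two isogeny classes of simple surface factors per Galois closure

COR-CM (cell `pub-hodgecm2`, binder seat `b16` gen 44, count-neutral claim CM-DIMLE3-INTRINSIC, file F2 — THE CLASSIFICATION;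
theorems only, no definition, no named fact, no `sorry`).  NEW as stated (an assembly of tree theorems), hence under
`Summits/`.  HONEST FRAMING: an unconditional classification theorem for complex abelian varieties of CM type in EVERY
dimension, read on the variety; not a step of the summit chain (`HC_CM` is neither used nor advanced).

THE THEOREM (`forall_isDivisorGenerated_powSucc_iff_of_isOfCMType_of_factors_dim_le_three`).  Let `X` be a complex abelian
variety of CM type (`Milne1999.IsOfCMType X`) all of whose SIMPLE ISOGENY FACTORS (`B` simple with `Domination.AVDominatedBy B X`,
Mumford §19) have dimension `≤ 3` — any number of CM elliptic curves, simple CM surfaces and simple CM threefolds with any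
multiplicities, `dim X` arbitrary.  Then EVERY POWER `X^{N+1}` is divisor-generated (`B• = D• ⊗ ℂ`; equivalently no power,
no isogeny factor of a power, nothing dominated by a power carries an exotic Hodge class) IF AND ONLY IF

* (i′) there are NO two non-isogenous simple isogeny factors `B`, `B′` of `X` of positive dimension and an imaginary
  quadratic number field `k` with ring maps `k → End⁰(B)`, `k → End⁰(B′)`;
* (ii′) there are NO four pairwise non-isogenous simple abelian THREEFOLDS among the isogeny factors of `X` with pairwise
  isomorphic endomorphism algebras;
* (iii′) there are NO three pairwise non-isogenous simple abelian SURFACES among the isogeny factors of `X` whose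
  endomorphism fields have the same intrinsic Galois closure `⨆_{f : End⁰(S) →+* ℂ} ℚ(range f) ≤ ℂ`.

Then (`hodgeConjectureFor_of_avDominatedBy_powSucc_of_isOfCMType_of_factors_dim_le_three`) the Hodge conjecture holds, with
all Hodge classes polynomials in divisor classes, for EVERY complex abelian variety dominated by a power of `X`,
UNCONDITIONALLY; otherwise (`exists_not_isDivisorGenerated_powSucc_iff_…`) some power of `X` carries an exotic Hodge class.
This is the intrinsic form of seat b16 gen 43's census `isNondegenerateFamily_simpleFamily_dim_le_three_iff` and extends
seat b16 gen 38's `CorCM/CMAbelianFivefoldPowers` (Moonen–Zarhin (0.2) on the variety, `dim X ≤ 5`) to every dimension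
under the factor bound: Moonen–Zarhin's (a), (e), (f) are the curve cases of (i′); two threefolds through one imaginary
quadratic field, four threefolds of one sextic field and the dihedral surface triple first occur in dimensions `6`, `12`, `6`.

* §1 `isDivisorGenerated_of_avDominatedBy_powSucc_of_forall_factorFamily` — THE REDUCTION: if every finite family of
  simple, pairwise non-isogenous CM realisations ALL OF WHICH ARE ISOGENY FACTORS OF `X` is nondegenerate, then everything
  dominated by a power of `X` is divisor-generated (Milne's regrouping, seat b16 gen 36; Hazama–Murty; domination).
* §2 the classification for factors of dimension `≤ 3` (master form, Hodge conjecture, iff, dichotomy, class-target display).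
* The sequel `CorCM/CMAbelianFactorsDimLeTwoClassification` specialises to factors of dimension `≤ 2` (CM elliptic curves and
  simple CM surfaces), where (iii′) — the dihedral surface triple — is the only obstruction.

## References

* [MoonenZarhin1999LowDim] B. Moonen, Yu. Zarhin, *Hodge classes on abelian varieties of low dimension*, Math. Ann. 315
  (1999) 711–733, Thms. (0.1), (0.2); §3 (3.1), (3.9); §5.
* [Gordon1999HodgeAVSurvey] B. B. Gordon, *A survey of the Hodge conjecture for abelian varieties*, §3 Theorem, 7.5–7.7,
  9.4, 10.10.
* [MumfordAV1970] D. Mumford, *Abelian Varieties*, §19 Thm. 1, Cor. 1–2 (pp. 173–174).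
* [Milne1999LefschetzClasses] J. S. Milne, *Lefschetz classes on abelian varieties*, Duke Math. J. 96 (1999), §1 Prop. 1.1,
  Prop. 4.8.
* [vanGeemen1994HodgeAV] B. van Geemen, *An introduction to the Hodge conjecture for abelian varieties*, LNM 1594, §2.4–2.5,
  Lemma 3.7.
-/

noncomputable section

open CategoryTheory CategoryTheory.Limits NumberField Module IntermediateField
open scoped BigOperators

namespace Summit.HodgeConjecture.CorCM

open Literature.NumberTheory.ComplexMultiplication
open Literature.AlgebraicGeometry.Motives (AbelianVariety CMType)
open Literature.AlgebraicGeometry.Motives.AbelianVariety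
open Literature.AlgebraicGeometry.HodgeTheory
open Literature.AlgebraicGeometry.ComplexMultiplication (IsCMTypeRealisation)
open Literature.AlgebraicGeometry.VanGeemen1994 (hodgeClassSpan)
open Literature.AlgebraicGeometry.Milne1999
open Literature.AlgebraicGeometry.Pohlmann1968
open Literature.Barriers.HodgeConjecture (divisorClassesSpan)
open Summit.HodgeConjecture.CorCM.Domination
open Summit.HodgeConjecture.HodgeConjecture.Ring2.ClassTargets (HCOnClass)
open Summit.HodgeConjecture.HodgeConjecture.Ring2.Atlas (nonempty_ringEquiv_endAlgebra_of_isSimple)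

variable {X : AbelianVariety ℂ}

/-! ## §1 The reduction to families of isogeny factors -/

section Reduction

/-- Powers of a zero-dimensional abelian variety are zero-dimensional. [folklore] -/
private theorem dim_powSucc_eq_zero' (h0 : X.dim = 0) : ∀ N : ℕ, (X.powSucc N).dim = 0
  | 0 => h0
  | N + 1 => by rw [powSucc_succ, dim_prod, dim_powSucc_eq_zero' h0 N, h0]

/-- **THE REDUCTION (Hazama's principle on the variety).**  Let `X` be a complex abelian variety of CM type such that EVERY
finite family `(K_c; Φ_c; A_c, ι_c, θ_c)` of SIMPLE, PAIRWISE NON-ISOGENOUS CM realisations ALL OF WHICH ARE ISOGENY FACTORS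
OF `X` is nondegenerate.  Then every complex abelian variety `B` dominated by a power `X^{N+1}` is divisor-generated.
(Milne's regrouping `X ∼ ⨁ᵢ A'_{cls i}` is such a family; `B ≼ X^{N+1} ≼ ⨁_j A'_{π j}` and `B = D` there by stable
nondegeneracy, Hazama–Murty 7.5 (3) ⟹ (1); `B = D` descends along dominations.)
[cite: Gordon1999HodgeAVSurvey, 7.5 and 7.6.1] [cite: Milne1999LefschetzClasses, §1 Prop. 1.1] [cite: MumfordAV1970, §19] -/
theorem isDivisorGenerated_of_avDominatedBy_powSucc_of_forall_factorFamily (hcm : IsOfCMType X)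
    (H : ∀ (C : Type) [Fintype C] [Nonempty C] (K' : C → Type) [∀ c, Field (K' c)] [∀ c, NumberField (K' c)]
      [∀ c, IsCMField (K' c)] (Φ' : ∀ c, CMType (K' c)) (A' : C → AbelianVariety ℂ)
      (ι' : ∀ c, 𝓞 (K' c) →+* End (A' c)) (θ' : ∀ c, K' c →+* Module.End ℂ (complexBetti (A' c).X 1)),
      (∀ c, IsCMTypeRealisation (Φ' c) (A' c) (ι' c) (θ' c)) → (∀ c, (A' c).IsSimple) →
      (∀ c c', c ≠ c' → ¬ IsIsogenous (A' c) (A' c')) → (∀ c, AVDominatedBy (A' c) X) →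
      CMAlgebra.IsNondegenerateFamily Φ')
    {B : AbelianVariety ℂ} {N : ℕ} (hB : AVDominatedBy B (X.powSucc N)) : IsDivisorGenerated B := by
  classical
  rcases Nat.eq_zero_or_pos X.dim with h0 | hX0
  · exact isDivisorGenerated_of_avDominatedBy hB (isDivisorGenerated_of_dim_eq_zero _ (dim_powSucc_eq_zero' h0 N))
  obtain ⟨C, _, K', _, _, _, Φ', A', ι', θ', m, cls, f, hA, hs, hniso, hcls, hf⟩ :=
    exists_isIsogeny_biproduct_of_isSimple_of_isOfCMType (X := X) hX0 hcm
  haveI : Nonempty C := ⟨cls 0⟩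
  have hXP : AVDominatedBy X (⨁ fun i => A' (cls i)) := AVDominatedBy.of_isIsogeny_hom hf (AVDominatedBy.refl _)
  have hPX : AVDominatedBy (⨁ fun i => A' (cls i)) X := AVDominatedBy.of_isIsogeny_inv hf (AVDominatedBy.refl _)
  have hslot : ∀ c, AVDominatedBy (A' c) X := fun c => by
    obtain ⟨i, rfl⟩ := hcls c
    exact (avDominatedBy_biproduct_summand (fun i => A' (cls i)) i).trans hPX
  have hnd : CMAlgebra.IsNondegenerateFamily Φ' := H C K' Φ' A' ι' θ' hA hs hniso hslot
  obtain ⟨n, π, hdom⟩ := exists_avDominatedBy_powSucc_biproduct_slots A' cls hXP N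
  refine isDivisorGenerated_of_avDominatedBy (hB.trans hdom) fun p c hcQ hcH => ?_
  rw [← hnd.hodgeClassSpan_prod_eq_divisorClassesSpan hA π p]
  exact Submodule.subset_span ⟨hcQ, hcH⟩

/-- Choosing `n` distinct elements of a finset with at least `n` elements, as an injection from `Fin n`. [folklore] -/
theorem exists_injective_fin_of_le_card {α : Type} {s : Finset α} {n : ℕ} (h : n ≤ s.card) :
    ∃ d : Fin n → α, Function.Injective d ∧ ∀ x, d x ∈ s :=
  ⟨fun x => (s.equivFin.symm (Fin.castLE h x)).1,
    fun _ _ hxy => Fin.castLE_injective h (s.equivFin.symm.injective (Subtype.ext hxy)),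
    fun x => (s.equivFin.symm (Fin.castLE h x)).2⟩

/-- A ring isomorphism of number fields preserves the degree. [folklore] -/
private theorem finrank_eq_of_ringEquiv' {K K' : Type} [Field K] [NumberField K] [Field K'] [NumberField K']
    (e : K ≃+* K') : finrank ℚ K = finrank ℚ K' :=
  (AlgEquiv.ofRingEquiv (f := e) fun q => by rw [eq_ratCast]; exact map_ratCast e q).toLinearEquiv.finrank_eq

end Reduction

/-! ## §2 Simple isogeny factors of dimension `≤ 3`: the classification -/

section DimLeThree

open scoped Classical in
/-- **MASTER FORM.**  Let `X` be a complex abelian variety of CM type all of whose simple isogeny factors have dimension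
`≤ 3`, satisfying (i′), (ii′), (iii′) of the module docstring.  Then every complex abelian variety `B` dominated by a power
`X^{N+1}` — every power, everything isogenous to a power, every abelian subvariety or quotient of a power, every product of
such — is divisor-generated.  (The reduction of §1: a family of simple, pairwise non-isogenous factors of `X` has members of
dimension `≤ 3` and satisfies the census (i), (ii), (iii) of `isNondegenerateFamily_simpleFamily_dim_le_three` — a violating
pair / quadruple / triple of slots would be, through `End⁰ ≅ K` (Shimura §5.1), a configuration excluded by (i′) / (ii′) /
(iii′).) UNCONDITIONAL. [cite: MoonenZarhin1999LowDim, Thms. (0.1), (0.2) (4) and §3] [cite: Gordon1999HodgeAVSurvey, 7.5–7.7 and 9.4]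
[cite: Shimura1998, §5.1 Props. 3–6 and §8.4] -/
theorem isDivisorGenerated_of_avDominatedBy_powSucc_of_isOfCMType_of_factors_dim_le_three (hcm : IsOfCMType X)
    (h3 : ∀ B : AbelianVariety ℂ, B.IsSimple → AVDominatedBy B X → B.dim ≤ 3)
    (hi : ¬ ∃ (B B' : AbelianVariety ℂ) (k : Type) (_ : Field k) (_ : NumberField k),
      B.IsSimple ∧ B'.IsSimple ∧ 0 < B.dim ∧ 0 < B'.dim ∧ AVDominatedBy B X ∧ AVDominatedBy B' X ∧
      ¬ IsIsogenous B B' ∧ IsTotallyComplex k ∧ finrank ℚ k = 2 ∧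
      Nonempty (k →+* B.endAlgebra) ∧ Nonempty (k →+* B'.endAlgebra))
    (hii : ¬ ∃ T : Fin 4 → AbelianVariety ℂ, (∀ a, (T a).IsSimple ∧ (T a).dim = 3 ∧ AVDominatedBy (T a) X) ∧
      (∀ a b, a ≠ b → ¬ IsIsogenous (T a) (T b)) ∧ ∀ a b, Nonempty ((T a).endAlgebra ≃+* (T b).endAlgebra))
    (hiii : ¬ ∃ S : Fin 3 → AbelianVariety ℂ, (∀ a, (S a).IsSimple ∧ (S a).dim = 2 ∧ AVDominatedBy (S a) X) ∧
      (∀ a b, a ≠ b → ¬ IsIsogenous (S a) (S b)) ∧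
      ∀ a b, (⨆ f : (S a).endAlgebra →+* ℂ, IntermediateField.adjoin ℚ (Set.range f)) =
        ⨆ f : (S b).endAlgebra →+* ℂ, IntermediateField.adjoin ℚ (Set.range f))
    {B : AbelianVariety ℂ} {N : ℕ} (hB : AVDominatedBy B (X.powSucc N)) : IsDivisorGenerated B := by
  classical
  refine isDivisorGenerated_of_avDominatedBy_powSucc_of_forall_factorFamily hcm ?_ hB
  intro C _ _ K' _ _ _ Φ' A' ι' θ' hA hs hniso hslot
  have heC : ∀ c, Nonempty (K' c ≃+* (A' c).endAlgebra) := fun c =>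
    nonempty_ringEquiv_endAlgebra_of_isSimple (hA c) (hs c)
  have hpos : ∀ c, 0 < (A' c).dim := fun c => by
    have h := finrank_eq_two_mul_dim_of_isCMTypeRealisation (hA c)
    have hp : 0 < finrank ℚ (K' c) := Module.finrank_pos
    omega
  have h3c : ∀ c, (A' c).dim ≤ 3 := fun c => h3 _ (hs c) (hslot c)
  refine isNondegenerateFamily_simpleFamily_dim_le_three hA hs hniso h3c ?_ ?_ ?_
  · -- (i): a shared totally complex quadratic subfield would violate (i′)
    rintro a b hab ⟨F, hF2, hFc, ⟨g⟩⟩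
    obtain ⟨ea⟩ := heC a
    obtain ⟨eb⟩ := heC b
    exact hi ⟨A' a, A' b, F, inferInstance, inferInstance, hs a, hs b, hpos a, hpos b, hslot a, hslot b, hniso a b hab,
      hFc, hF2, ⟨ea.toRingHom.comp F.val.toRingHom⟩, ⟨eb.toRingHom.comp g⟩⟩
  · -- (ii): four slots with one sextic field up to isomorphism would violate (ii′)
    intro a h6
    by_contra hlt
    push Not at hlt
    obtain ⟨d, hd, hdmem⟩ := exists_injective_fin_of_le_card (n := 4) (by omega : 4 ≤ _) (s := Finset.univ.filter
      fun b => Nonempty (K' b ≃+* K' a))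
    have heK : ∀ x, Nonempty (K' (d x) ≃+* K' a) := fun x => (Finset.mem_filter.1 (hdmem x)).2
    have h3d : ∀ x, (A' (d x)).dim = 3 := fun x => by
      obtain ⟨e⟩ := heK x
      have h := finrank_eq_two_mul_dim_of_isCMTypeRealisation (hA (d x))
      rw [finrank_eq_of_ringEquiv' e, h6] at h
      omega
    refine hii ⟨fun x => A' (d x), fun x => ⟨hs (d x), h3d x, hslot (d x)⟩, fun x y hxy => hniso _ _ (hd.ne hxy),
      fun x y => ?_⟩
    obtain ⟨ex⟩ := heC (d x)
    obtain ⟨ey⟩ := heC (d y)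
    obtain ⟨ux⟩ := heK x
    obtain ⟨uy⟩ := heK y
    exact ⟨(ex.symm.trans (ux.trans uy.symm)).trans ey⟩
  · -- (iii): three quartic slots with one Galois closure would violate (iii′)
    intro a h4
    by_contra hlt
    push Not at hlt
    obtain ⟨d, hd, hdmem⟩ := exists_injective_fin_of_le_card (n := 3) (by omega : 3 ≤ _) (s := Finset.univ.filter
      fun b => normalClosure ℚ (K' b) ℂ = normalClosure ℚ (K' a) ℂ)
    have hLK : ∀ x, normalClosure ℚ (K' (d x)) ℂ = normalClosure ℚ (K' a) ℂ := fun x => (Finset.mem_filter.1 (hdmem x)).2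
    have h2d : ∀ x, (A' (d x)).dim = 2 := fun x => by
      have h := finrank_eq_two_mul_dim_of_isCMTypeRealisation (hA (d x))
      rw [finrank_eq_of_normalClosure_eq hA h3c (hLK x), h4] at h
      omega
    refine hiii ⟨fun x => A' (d x), fun x => ⟨hs (d x), h2d x, hslot (d x)⟩, fun x y hxy => hniso _ _ (hd.ne hxy),
      fun x y => ?_⟩
    obtain ⟨ex⟩ := heC (d x)
    obtain ⟨ey⟩ := heC (d y)
    change (⨆ f : (A' (d x)).endAlgebra →+* ℂ, IntermediateField.adjoin ℚ (Set.range f)) =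
      ⨆ f : (A' (d y)).endAlgebra →+* ℂ, IntermediateField.adjoin ℚ (Set.range f)
    rw [iSup_adjoin_range_eq_normalClosure ex, iSup_adjoin_range_eq_normalClosure ey, hLK x, hLK y]

/-- **The Hodge conjecture for everything dominated by a power of a CM abelian variety whose simple isogeny factors have
dimension `≤ 3` and satisfy (i′), (ii′), (iii′)** — all Hodge classes polynomials in divisor classes, UNCONDITIONALLY.
[cite: MoonenZarhin1999LowDim, Thm. (0.2) (4)] [cite: Gordon1999HodgeAVSurvey, 10.10] [cite: vanGeemen1994HodgeAV, §2.4] -/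
theorem hodgeConjectureFor_of_avDominatedBy_powSucc_of_isOfCMType_of_factors_dim_le_three (hcm : IsOfCMType X)
    (h3 : ∀ B : AbelianVariety ℂ, B.IsSimple → AVDominatedBy B X → B.dim ≤ 3)
    (hi : ¬ ∃ (B B' : AbelianVariety ℂ) (k : Type) (_ : Field k) (_ : NumberField k),
      B.IsSimple ∧ B'.IsSimple ∧ 0 < B.dim ∧ 0 < B'.dim ∧ AVDominatedBy B X ∧ AVDominatedBy B' X ∧
      ¬ IsIsogenous B B' ∧ IsTotallyComplex k ∧ finrank ℚ k = 2 ∧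
      Nonempty (k →+* B.endAlgebra) ∧ Nonempty (k →+* B'.endAlgebra))
    (hii : ¬ ∃ T : Fin 4 → AbelianVariety ℂ, (∀ a, (T a).IsSimple ∧ (T a).dim = 3 ∧ AVDominatedBy (T a) X) ∧
      (∀ a b, a ≠ b → ¬ IsIsogenous (T a) (T b)) ∧ ∀ a b, Nonempty ((T a).endAlgebra ≃+* (T b).endAlgebra))
    (hiii : ¬ ∃ S : Fin 3 → AbelianVariety ℂ, (∀ a, (S a).IsSimple ∧ (S a).dim = 2 ∧ AVDominatedBy (S a) X) ∧
      (∀ a b, a ≠ b → ¬ IsIsogenous (S a) (S b)) ∧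
      ∀ a b, (⨆ f : (S a).endAlgebra →+* ℂ, IntermediateField.adjoin ℚ (Set.range f)) =
        ⨆ f : (S b).endAlgebra →+* ℂ, IntermediateField.adjoin ℚ (Set.range f))
    {B : AbelianVariety ℂ} {N : ℕ} (hB : AVDominatedBy B (X.powSucc N)) : HodgeConjectureFor B.dim B.X :=
  hodgeConjectureFor_of_isDivisorGenerated _
    (isDivisorGenerated_of_avDominatedBy_powSucc_of_isOfCMType_of_factors_dim_le_three hcm h3 hi hii hiii hB)

/-- **THE CLASSIFICATION (every dimension, simple factors of dimension `≤ 3`).**  For a complex abelian variety `X` of CM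
type all of whose simple isogeny factors have dimension `≤ 3`: ALL POWERS `X^{N+1}` are divisor-generated IF AND ONLY IF
(i′) no imaginary quadratic number field maps into the endomorphism algebras of two non-isogenous simple isogeny factors of
positive dimension, (ii′) no four pairwise non-isogenous simple threefold factors have pairwise isomorphic endomorphism
algebras, and (iii′) no three pairwise non-isogenous simple surface factors have endomorphism fields with one intrinsic
Galois closure.  (⟸: the master form; ⟹: the three obstructions of `CorCM/CMAbelianFactorsDimLeThreeObstructions`, each in
every dimension.)  Moonen–Zarhin's (0.2) (a), (e), (f) are the curve instances of (i′); (ii′), (iii′) and the threefold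
instances of (i′) are invisible in dimension `≤ 5`. [cite: MoonenZarhin1999LowDim, Thms. (0.1), (0.2) and §3 (3.1), (3.9)]
[cite: Gordon1999HodgeAVSurvey, §3 Theorem, 7.5–7.7 and 9.4] -/
theorem forall_isDivisorGenerated_powSucc_iff_of_isOfCMType_of_factors_dim_le_three (hcm : IsOfCMType X)
    (h3 : ∀ B : AbelianVariety ℂ, B.IsSimple → AVDominatedBy B X → B.dim ≤ 3) :
    (∀ N : ℕ, IsDivisorGenerated (X.powSucc N)) ↔
      (¬ ∃ (B B' : AbelianVariety ℂ) (k : Type) (_ : Field k) (_ : NumberField k),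
          B.IsSimple ∧ B'.IsSimple ∧ 0 < B.dim ∧ 0 < B'.dim ∧ AVDominatedBy B X ∧ AVDominatedBy B' X ∧
          ¬ IsIsogenous B B' ∧ IsTotallyComplex k ∧ finrank ℚ k = 2 ∧
          Nonempty (k →+* B.endAlgebra) ∧ Nonempty (k →+* B'.endAlgebra)) ∧
      (¬ ∃ T : Fin 4 → AbelianVariety ℂ, (∀ a, (T a).IsSimple ∧ (T a).dim = 3 ∧ AVDominatedBy (T a) X) ∧
          (∀ a b, a ≠ b → ¬ IsIsogenous (T a) (T b)) ∧ ∀ a b, Nonempty ((T a).endAlgebra ≃+* (T b).endAlgebra)) ∧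
      (¬ ∃ S : Fin 3 → AbelianVariety ℂ, (∀ a, (S a).IsSimple ∧ (S a).dim = 2 ∧ AVDominatedBy (S a) X) ∧
          (∀ a b, a ≠ b → ¬ IsIsogenous (S a) (S b)) ∧
          ∀ a b, (⨆ f : (S a).endAlgebra →+* ℂ, IntermediateField.adjoin ℚ (Set.range f)) =
            ⨆ f : (S b).endAlgebra →+* ℂ, IntermediateField.adjoin ℚ (Set.range f)) := by
  refine ⟨fun h => ⟨?_, ?_, ?_⟩, fun h N =>
    isDivisorGenerated_of_avDominatedBy_powSucc_of_isOfCMType_of_factors_dim_le_three hcm h3 h.1 h.2.1 h.2.2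
      (AVDominatedBy.refl _)⟩
  · rintro ⟨B, B', k, _, _, hB, hB', hB0, hB'0, hBX, hB'X, hBB', hkc, hk2, ⟨j⟩, ⟨j'⟩⟩
    haveI : IsTotallyComplex k := hkc
    obtain ⟨N, hN⟩ := exists_not_isDivisorGenerated_powSucc_of_shared_imaginary_quadratic hcm hB hB' hB0 hB'0 hBX hB'X
      hBB' hk2 j j'
    exact hN (h N)
  · rintro ⟨T, hT, hTn, hTe⟩
    obtain ⟨N, hN⟩ := exists_not_isDivisorGenerated_powSucc_of_four_threefold_factors hcm (fun a => (hT a).1)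
      (fun a => (hT a).2.1) (fun a => (hT a).2.2) hTn hTe
    exact hN (h N)
  · rintro ⟨S, hS, hSn, hSe⟩
    obtain ⟨N, hN⟩ := exists_not_isDivisorGenerated_powSucc_of_three_surface_factors hcm (fun a => (hS a).1)
      (fun a => (hS a).2.1) (fun a => (hS a).2.2) hSn hSe
    exact hN (h N)

/-- **THE DICHOTOMY.**  For `X` of CM type with simple isogeny factors of dimension `≤ 3`: SOME power `X^{N+1}` carries an
exotic Hodge class — a rational `(p,p)`-class outside `Dᵖ ⊗ ℂ` — iff one of the three configurations (¬i′), (¬ii′), (¬iii′)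
occurs among its simple isogeny factors: shared imaginary quadratic fields, four isogeny classes of one sextic field, three
surfaces in one Galois closure are the ONLY sources of exotic Hodge classes on powers of CM abelian varieties with small
factors. [cite: MoonenZarhin1999LowDim, Thms. (0.1), (0.2)] [cite: Gordon1999HodgeAVSurvey, 7.5 and 9.4] -/
theorem exists_not_isDivisorGenerated_powSucc_iff_of_isOfCMType_of_factors_dim_le_three (hcm : IsOfCMType X)
    (h3 : ∀ B : AbelianVariety ℂ, B.IsSimple → AVDominatedBy B X → B.dim ≤ 3) :
    (∃ (N p : ℕ) (c : complexBetti (X.powSucc N).X (2 * p)), IsRationalClass c ∧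
        IsOfHodgeType (X.powSucc N).dim (X.powSucc N).X (2 * p) p p c ∧
        c ∉ divisorClassesSpan (X.powSucc N).X (X.powSucc N).dim p) ↔
      (∃ (B B' : AbelianVariety ℂ) (k : Type) (_ : Field k) (_ : NumberField k),
          B.IsSimple ∧ B'.IsSimple ∧ 0 < B.dim ∧ 0 < B'.dim ∧ AVDominatedBy B X ∧ AVDominatedBy B' X ∧
          ¬ IsIsogenous B B' ∧ IsTotallyComplex k ∧ finrank ℚ k = 2 ∧
          Nonempty (k →+* B.endAlgebra) ∧ Nonempty (k →+* B'.endAlgebra)) ∨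
      (∃ T : Fin 4 → AbelianVariety ℂ, (∀ a, (T a).IsSimple ∧ (T a).dim = 3 ∧ AVDominatedBy (T a) X) ∧
          (∀ a b, a ≠ b → ¬ IsIsogenous (T a) (T b)) ∧ ∀ a b, Nonempty ((T a).endAlgebra ≃+* (T b).endAlgebra)) ∨
      (∃ S : Fin 3 → AbelianVariety ℂ, (∀ a, (S a).IsSimple ∧ (S a).dim = 2 ∧ AVDominatedBy (S a) X) ∧
          (∀ a b, a ≠ b → ¬ IsIsogenous (S a) (S b)) ∧
          ∀ a b, (⨆ f : (S a).endAlgebra →+* ℂ, IntermediateField.adjoin ℚ (Set.range f)) =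
            ⨆ f : (S b).endAlgebra →+* ℂ, IntermediateField.adjoin ℚ (Set.range f)) := by
  have key := forall_isDivisorGenerated_powSucc_iff_of_isOfCMType_of_factors_dim_le_three hcm h3
  constructor
  · rintro ⟨N, p, c, hcQ, hcH, hcD⟩
    by_contra hnone
    exact hcD (key.2 ⟨fun h => hnone (Or.inl h), fun h => hnone (Or.inr (Or.inl h)),
      fun h => hnone (Or.inr (Or.inr h))⟩ N p c hcQ hcH)
  · intro hcfg
    by_contra hnone
    push Not at hnone
    have hall : ∀ N : ℕ, IsDivisorGenerated (X.powSucc N) := fun N p c hcQ hcH => hnone N p c hcQ hcH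
    obtain ⟨h1, h2, h3'⟩ := key.1 hall
    rcases hcfg with h | h | h
    · exact h1 h
    · exact h2 h
    · exact h3' h

/-- **Class-target display** (`Ring2.ClassTargets.HCOnClass`): the Hodge conjecture on the class of complex abelian varieties
dominated by a power of a CM abelian variety whose simple isogeny factors have dimension `≤ 3` and satisfy (i′), (ii′), (iii′).
UNCONDITIONAL. [cite: MoonenZarhin1999LowDim, Thm. (0.2) (4)] [cite: Gordon1999HodgeAVSurvey, 10.10] -/
theorem hcOnClass_avDominatedBy_powSucc_isOfCMType_factors_dim_le_three :
    HCOnClass fun B => ∃ (X : AbelianVariety ℂ) (N : ℕ), IsOfCMType X ∧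
      (∀ B : AbelianVariety ℂ, B.IsSimple → AVDominatedBy B X → B.dim ≤ 3) ∧
      (¬ ∃ (B B' : AbelianVariety ℂ) (k : Type) (_ : Field k) (_ : NumberField k),
          B.IsSimple ∧ B'.IsSimple ∧ 0 < B.dim ∧ 0 < B'.dim ∧ AVDominatedBy B X ∧ AVDominatedBy B' X ∧
          ¬ IsIsogenous B B' ∧ IsTotallyComplex k ∧ finrank ℚ k = 2 ∧
          Nonempty (k →+* B.endAlgebra) ∧ Nonempty (k →+* B'.endAlgebra)) ∧
      (¬ ∃ T : Fin 4 → AbelianVariety ℂ, (∀ a, (T a).IsSimple ∧ (T a).dim = 3 ∧ AVDominatedBy (T a) X) ∧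
          (∀ a b, a ≠ b → ¬ IsIsogenous (T a) (T b)) ∧ ∀ a b, Nonempty ((T a).endAlgebra ≃+* (T b).endAlgebra)) ∧
      (¬ ∃ S : Fin 3 → AbelianVariety ℂ, (∀ a, (S a).IsSimple ∧ (S a).dim = 2 ∧ AVDominatedBy (S a) X) ∧
          (∀ a b, a ≠ b → ¬ IsIsogenous (S a) (S b)) ∧
          ∀ a b, (⨆ f : (S a).endAlgebra →+* ℂ, IntermediateField.adjoin ℚ (Set.range f)) =
            ⨆ f : (S b).endAlgebra →+* ℂ, IntermediateField.adjoin ℚ (Set.range f)) ∧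
      AVDominatedBy B (X.powSucc N) :=
  fun _ ⟨_, _, hcm, h3, hi, hii, hiii, hB⟩ =>
    hodgeConjectureFor_of_avDominatedBy_powSucc_of_isOfCMType_of_factors_dim_le_three hcm h3 hi hii hiii hB

end DimLeThree

end Summit.HodgeConjecture.CorCM

end
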